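import Mathlib.MeasureTheory.Integral.IntervalIntegral.FundThmCalculus
import Mathlib.MeasureTheory.Integral.IntervalIntegral.IntegrationByParts
import Mathlib.Analysis.SpecialFunctions.Integrals.Basic
import HarnessLib

/-!
# `L¹`-limits of primitives on an interval are primitives (closedness of `d/dx` in `L¹`)

Analysis/FunctionSpaces support file (everything proved; no definitions, no named facts). The elementary
one-dimensional half of the ACL characterisation of Sobolev functions (Evans–Gariepy, *Measure Theory and Fine
Properties of Functions*, §4.9.2 Thm. 2; Ziemer, *Weakly Differentiable Functions*, Thm. 2.1.4): on a compact
interval `[A, B]`, if `C¹` functions `φₖ` converge to `f` in `L¹` and their (continuous) derivatives `ψₖ = φₖ'`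
converge to `g` in `L¹`, then `f` has a continuous representative `F` with

  `F b - F a = ∫_a^b g`   for all `a, b ∈ [A, B]`,

and `φₖ → F` POINTWISE (indeed uniformly) on `[A, B]` along the full sequence (`exists_primitive_of_tendsto_L1`). The
pointwise convergence along the full sequence is what, applied line by line to one sequence of smooth approximants on a
product space, produces ONE globally defined representative that is absolutely continuous on almost every line.

Proof: `φₖ(x) = Mₖ + (B-A)⁻¹ ∫_A^B (∫_a^x ψₖ) da` with the mean `Mₖ = (B-A)⁻¹∫_A^B φₖ` (fundamental theorem of calculus
and `∫_A^B (φₖ(x) - φₖ(a)) da = (B-A)φₖ(x) - ∫φₖ`); put `F(x) = M + (B-A)⁻¹∫_A^B (∫_a^x g) da` with the mean `M` of `f`;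
then `‖φₖ(x) - F(x)‖ ≤ ‖Mₖ - M‖ + (B-A)⁻¹·(B-A)·∫_A^B ‖ψₖ - g‖ → 0` uniformly in `x`. No Fubini is used.

References: L. C. Evans, R. F. Gariepy, *Measure Theory and Fine Properties of Functions* (CRC 1992), §4.9.2;
W. P. Ziemer, *Weakly Differentiable Functions* (Springer 1989), Thm. 2.1.4. Tagged folklore.
-/

noncomputable section

open MeasureTheory Set Filter Topology intervalIntegral
open scoped Interval

namespace Literature.Analysis.FunctionSpaces

variable {E : Type*} [NormedAddCommGroup E] [NormedSpace ℝ E] [CompleteSpace E]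

omit [CompleteSpace E] in
/-- `‖∫_a^x h‖ ≤ ∫_A^B ‖h‖` for `a, x ∈ [A, B]`. [folklore] -/
theorem norm_intervalIntegral_le_of_mem_Icc {A B a x : ℝ} (hAB : A ≤ B) (ha : a ∈ Icc A B) (hx : x ∈ Icc A B)
    {h : ℝ → E} (hh : IntervalIntegrable h volume A B) :
    ‖∫ y in a..x, h y‖ ≤ ∫ y in A..B, ‖h y‖ := by
  have hint : IntegrableOn (fun y => ‖h y‖) (Ioc A B) volume := by
    have h1 := hh.norm
    rw [intervalIntegrable_iff, uIoc_of_le hAB] at h1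
    exact h1
  calc ‖∫ y in a..x, h y‖ ≤ ∫ y in Ι a x, ‖h y‖ := norm_integral_le_integral_norm_uIoc
    _ ≤ ∫ y in Ioc A B, ‖h y‖ := by
        refine setIntegral_mono_set hint (Eventually.of_forall fun y => norm_nonneg _) (Eventually.of_forall ?_)
        intro y hy
        have hy' : y ∈ Ioc (min a x) (max a x) := hy
        exact ⟨lt_of_le_of_lt (le_min ha.1 hx.1) hy'.1, hy'.2.trans (max_le ha.2 hx.2)⟩
    _ = ∫ y in A..B, ‖h y‖ := (integral_of_le hAB).symm

omit [NormedSpace ℝ E] [CompleteSpace E] in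
/-- An interval-integrable function on `[A, B]` is interval integrable on every sub-interval. [folklore] -/
theorem intervalIntegrable_of_mem_Icc {A B a b : ℝ} (hAB : A ≤ B) (ha : a ∈ Icc A B) (hb : b ∈ Icc A B)
    {h : ℝ → E} (hh : IntervalIntegrable h volume A B) : IntervalIntegrable h volume a b :=
  hh.mono_set (by rw [uIcc_of_le hAB]; exact uIcc_subset_Icc ha hb)

omit [CompleteSpace E] in
/-- The primitive with variable LOWER limit, `a ↦ ∫_a^x h`, is continuous on `[A, B]` (`x ∈ [A, B]`). [folklore] -/
theorem continuousOn_primitive_lower {A B x : ℝ} (hAB : A ≤ B) (hx : x ∈ Icc A B) {h : ℝ → E}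
    (hh : IntervalIntegrable h volume A B) : ContinuousOn (fun a => ∫ y in a..x, h y) (Icc A B) := by
  have hint : IntegrableOn h (uIcc A B) volume := by
    rw [uIcc_of_le hAB]
    have h1 := hh
    rw [intervalIntegrable_iff_integrableOn_Icc_of_le hAB] at h1
    exact h1
  have hprim : ContinuousOn (fun a => ∫ y in A..a, h y) (Icc A B) := by
    have h1 := continuousOn_primitive_interval (μ := volume) (a := A) (b := B) hint
    rwa [uIcc_of_le hAB] at h1
  have heq : ∀ a ∈ Icc A B, ∫ y in a..x, h y = (∫ y in A..x, h y) - ∫ y in A..a, h y := fun a ha => by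
    rw [eq_sub_iff_add_eq, add_comm,
      integral_add_adjacent_intervals (intervalIntegrable_of_mem_Icc hAB (left_mem_Icc.2 hAB) ha hh)
        (intervalIntegrable_of_mem_Icc hAB ha hx hh)]
  exact (continuousOn_const.sub hprim).congr heq

/-- **`L¹`-limits of primitives are primitives.** On `[A, B]` (`A < B`): if `φₖ` has the continuous derivative `ψₖ`,
`φₖ → f` and `ψₖ → g` in `L¹(A, B)`, then there is `F`, continuous on `[A, B]`, with `φₖ(x) → F(x)` for EVERY
`x ∈ [A, B]`, `F b - F a = ∫_a^b g` for all `a, b ∈ [A, B]`, and `f = F` a.e. on `[A, B]`. [folklore] -/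
theorem exists_primitive_of_tendsto_L1 {A B : ℝ} (hAB : A < B) {φ ψ : ℕ → ℝ → E}
    (hderiv : ∀ k x, HasDerivAt (φ k) (ψ k x) x) (hψc : ∀ k, Continuous (ψ k)) {f g : ℝ → E}
    (hfi : IntervalIntegrable f volume A B) (hgi : IntervalIntegrable g volume A B)
    (hφ : Tendsto (fun k => ∫ x in A..B, ‖φ k x - f x‖) atTop (𝓝 0))
    (hψ : Tendsto (fun k => ∫ x in A..B, ‖ψ k x - g x‖) atTop (𝓝 0)) :
    ∃ F : ℝ → E, ContinuousOn F (Icc A B) ∧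
      (∀ x ∈ Icc A B, Tendsto (fun k => φ k x) atTop (𝓝 (F x))) ∧
      (∀ a ∈ Icc A B, ∀ b ∈ Icc A B, F b - F a = ∫ x in a..b, g x) ∧
      (∀ᵐ x ∂(volume.restrict (Icc A B)), f x = F x) := by
  have hAB' : A ≤ B := hAB.le
  have hBA : 0 < B - A := sub_pos.2 hAB
  have hφc : ∀ k, Continuous (φ k) := fun k => continuous_iff_continuousAt.2 fun x => (hderiv k x).continuousAt
  have hφi : ∀ k a b, IntervalIntegrable (φ k) volume a b := fun k a b => (hφc k).intervalIntegrable a b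
  have hψi : ∀ k a b, IntervalIntegrable (ψ k) volume a b := fun k a b => (hψc k).intervalIntegrable a b
  -- the means
  set M : ℕ → E := fun k => (B - A)⁻¹ • ∫ x in A..B, φ k x with hM
  set Mf : E := (B - A)⁻¹ • ∫ x in A..B, f x with hMf
  -- the candidate representative
  set F : ℝ → E := fun x => Mf + (B - A)⁻¹ • ∫ a in A..B, (∫ y in a..x, g y) with hF
  -- Step 1: the representation of `φ k` through its mean and its derivative
  have hrep : ∀ k, ∀ x ∈ Icc A B, φ k x = M k + (B - A)⁻¹ • ∫ a in A..B, (∫ y in a..x, ψ k y) := by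
    intro k x hx
    have hftc : ∀ a, ∫ y in a..x, ψ k y = φ k x - φ k a := fun a =>
      integral_eq_sub_of_hasDerivAt (fun y _ => hderiv k y) (hψi k a x)
    simp only [hftc]
    rw [intervalIntegral.integral_sub intervalIntegrable_const (hφi k A B), intervalIntegral.integral_const, smul_sub, hM,
      ← smul_assoc, smul_eq_mul, inv_mul_cancel₀ hBA.ne', one_smul]
    abel
  -- Step 2: the uniform bound `‖φ k x - F x‖ ≤ ‖M k - Mf‖ + ∫ ‖ψ k - g‖`
  have hdiffi : ∀ k, IntervalIntegrable (fun y => ψ k y - g y) volume A B := fun k => (hψi k A B).sub hgi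
  have hbound : ∀ k, ∀ x ∈ Icc A B, ‖φ k x - F x‖ ≤ ‖M k - Mf‖ + ∫ y in A..B, ‖ψ k y - g y‖ := by
    intro k x hx
    have hinner : ∀ a ∈ Icc A B, ∫ y in a..x, (ψ k y - g y) = (∫ y in a..x, ψ k y) - ∫ y in a..x, g y :=
      fun a ha => intervalIntegral.integral_sub (hψi k a x) (intervalIntegrable_of_mem_Icc hAB' ha hx hgi)
    have hI1 : IntervalIntegrable (fun a => ∫ y in a..x, ψ k y) volume A B :=
      (continuousOn_primitive_lower hAB' hx (hψi k A B)).intervalIntegrable_of_Icc hAB'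
    have hI2 : IntervalIntegrable (fun a => ∫ y in a..x, g y) volume A B :=
      (continuousOn_primitive_lower hAB' hx hgi).intervalIntegrable_of_Icc hAB'
    have hdiff : φ k x - F x = (M k - Mf) + (B - A)⁻¹ • ∫ a in A..B, (∫ y in a..x, (ψ k y - g y)) := by
      rw [hrep k x hx, hF]
      dsimp only
      rw [intervalIntegral.integral_congr (fun a ha => hinner a (by rwa [uIcc_of_le hAB'] at ha)),
        intervalIntegral.integral_sub hI1 hI2, smul_sub]
      abel
    rw [hdiff]
    refine (norm_add_le _ _).trans (add_le_add le_rfl ?_)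
    rw [norm_smul, norm_inv, Real.norm_of_nonneg hBA.le]
    have hle : ‖∫ a in A..B, (∫ y in a..x, (ψ k y - g y))‖ ≤ (B - A) * ∫ y in A..B, ‖ψ k y - g y‖ := by
      have h1 : ‖∫ a in A..B, (∫ y in a..x, (ψ k y - g y))‖ ≤ ∫ a in A..B, ‖∫ y in a..x, (ψ k y - g y)‖ :=
        norm_integral_le_integral_norm hAB'
      have h2 : ∫ a in A..B, ‖∫ y in a..x, (ψ k y - g y)‖ ≤ ∫ _a in A..B, (∫ y in A..B, ‖ψ k y - g y‖) := by
        refine intervalIntegral.integral_mono_on hAB' ?_ intervalIntegrable_const fun a ha => ?_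
        · exact ((continuousOn_primitive_lower hAB' hx (hdiffi k)).intervalIntegrable_of_Icc hAB').norm
        · exact norm_intervalIntegral_le_of_mem_Icc hAB' ha hx (hdiffi k)
      rw [intervalIntegral.integral_const, smul_eq_mul] at h2
      exact h1.trans h2
    calc (B - A)⁻¹ * ‖∫ a in A..B, (∫ y in a..x, (ψ k y - g y))‖ ≤ (B - A)⁻¹ * ((B - A) * ∫ y in A..B, ‖ψ k y - g y‖) :=
          mul_le_mul_of_nonneg_left hle (inv_nonneg.2 hBA.le)
      _ = ∫ y in A..B, ‖ψ k y - g y‖ := by rw [← mul_assoc, inv_mul_cancel₀ hBA.ne', one_mul]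
  -- Step 3: the means converge
  have hMlim : Tendsto (fun k => ‖M k - Mf‖) atTop (𝓝 0) := by
    have hle : ∀ k, ‖M k - Mf‖ ≤ (B - A)⁻¹ * ∫ x in A..B, ‖φ k x - f x‖ := fun k => by
      rw [hM, hMf, ← smul_sub, ← intervalIntegral.integral_sub (hφi k A B) hfi, norm_smul, norm_inv,
        Real.norm_of_nonneg hBA.le]
      exact mul_le_mul_of_nonneg_left (norm_integral_le_integral_norm hAB') (inv_nonneg.2 hBA.le)
    refine squeeze_zero (fun k => norm_nonneg _) hle ?_
    have h := hφ.const_mul (B - A)⁻¹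
    rwa [mul_zero] at h
  have hunif : Tendsto (fun k => ‖M k - Mf‖ + ∫ y in A..B, ‖ψ k y - g y‖) atTop (𝓝 0) := by
    have h := hMlim.add hψ
    rwa [add_zero] at h
  -- Step 4: the four conclusions
  have hFsub : ∀ a ∈ Icc A B, ∀ b ∈ Icc A B, F b - F a = ∫ x in a..b, g x := by
    intro a ha b hb
    rw [hF]
    dsimp only
    have hIb : IntervalIntegrable (fun c => ∫ y in c..b, g y) volume A B :=
      (continuousOn_primitive_lower hAB' hb hgi).intervalIntegrable_of_Icc hAB'
    have hIa : IntervalIntegrable (fun c => ∫ y in c..a, g y) volume A B :=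
      (continuousOn_primitive_lower hAB' ha hgi).intervalIntegrable_of_Icc hAB'
    rw [add_sub_add_left_eq_sub, ← smul_sub, ← intervalIntegral.integral_sub hIb hIa]
    have hpt : ∀ c ∈ uIcc A B, (∫ y in c..b, g y) - ∫ y in c..a, g y = ∫ y in a..b, g y := fun c hc => by
      rw [uIcc_of_le hAB'] at hc
      exact integral_interval_sub_left (intervalIntegrable_of_mem_Icc hAB' hc hb hgi) (intervalIntegrable_of_mem_Icc hAB' hc ha hgi)
    rw [intervalIntegral.integral_congr hpt, intervalIntegral.integral_const, ← smul_assoc, smul_eq_mul,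
      inv_mul_cancel₀ hBA.ne', one_smul]
  have hFcont : ContinuousOn F (Icc A B) := by
    have heq : ∀ x ∈ Icc A B, F x = F A + ∫ y in A..x, g y := fun x hx => by
      rw [← hFsub A (left_mem_Icc.2 hAB') x hx]; abel
    have hint : IntegrableOn g (uIcc A B) volume := by
      rw [uIcc_of_le hAB']
      exact (intervalIntegrable_iff_integrableOn_Icc_of_le hAB').1 hgi
    have hprim := continuousOn_primitive_interval (μ := volume) (a := A) (b := B) hint
    rw [uIcc_of_le hAB'] at hprim
    exact (continuousOn_const.add hprim).congr heq
  have hptw : ∀ x ∈ Icc A B, Tendsto (fun k => φ k x) atTop (𝓝 (F x)) := fun x hx => by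
    rw [tendsto_iff_norm_sub_tendsto_zero]
    exact squeeze_zero (fun k => norm_nonneg _) (fun k => hbound k x hx) hunif
  refine ⟨F, hFcont, hptw, hFsub, ?_⟩
  -- `f = F` a.e.: `∫_{[A,B]} ‖f - F‖ ≤ ∫ ‖f - φ k‖ + (B - A) sup ‖φ k - F‖ → 0`
  have hFi : IntervalIntegrable F volume A B := hFcont.intervalIntegrable_of_Icc hAB'
  have hle : ∀ k, ∫ x in A..B, ‖f x - F x‖ ≤
      (∫ x in A..B, ‖φ k x - f x‖) + (B - A) * (‖M k - Mf‖ + ∫ y in A..B, ‖ψ k y - g y‖) := by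
    intro k
    calc ∫ x in A..B, ‖f x - F x‖ ≤ ∫ x in A..B, (‖φ k x - f x‖ + ‖φ k x - F x‖) := by
          refine intervalIntegral.integral_mono_on hAB' (hfi.sub hFi).norm
            (((hφi k A B).sub hfi).norm.add ((hφi k A B).sub hFi).norm) fun x _ => ?_
          calc ‖f x - F x‖ = ‖(φ k x - F x) - (φ k x - f x)‖ := by congr 1; abel
            _ ≤ ‖φ k x - F x‖ + ‖φ k x - f x‖ := norm_sub_le _ _
            _ = ‖φ k x - f x‖ + ‖φ k x - F x‖ := add_comm _ _
      _ = (∫ x in A..B, ‖φ k x - f x‖) + ∫ x in A..B, ‖φ k x - F x‖ :=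
          intervalIntegral.integral_add ((hφi k A B).sub hfi).norm ((hφi k A B).sub hFi).norm
      _ ≤ (∫ x in A..B, ‖φ k x - f x‖) + ∫ _x in A..B, (‖M k - Mf‖ + ∫ y in A..B, ‖ψ k y - g y‖) := by
          gcongr
          exact intervalIntegral.integral_mono_on hAB' ((hφi k A B).sub hFi).norm intervalIntegrable_const
            fun x hx => hbound k x hx
      _ = _ := by rw [intervalIntegral.integral_const, smul_eq_mul]
  have hzero : ∫ x in A..B, ‖f x - F x‖ = 0 := by
    refine le_antisymm (ge_of_tendsto (x := atTop) ?_ (Eventually.of_forall hle))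
      (intervalIntegral.integral_nonneg hAB' fun x _ => norm_nonneg _)
    have h := hφ.add (hunif.const_mul (B - A))
    rwa [mul_zero, add_zero] at h
  have hae : (fun x => ‖f x - F x‖) =ᵐ[volume.restrict (Ioc A B)] 0 :=
    (integral_eq_zero_iff_of_le_of_nonneg_ae hAB' (Eventually.of_forall fun x => norm_nonneg _) (hfi.sub hFi).norm).1
      hzero
  rw [← restrict_Ioc_eq_restrict_Icc]
  filter_upwards [hae] with x hx
  simpa [sub_eq_zero] using hx


/-- **Whole-line form.** If `φₖ' = ψₖ` (continuous), and on EVERY interval `[-M, M]` the functions `φₖ → f`, `ψₖ → g`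
in `L¹` with `f, g` locally integrable, then `g` is integrable on every `[a, b]` and the pointwise limits
`Φ(x) := lim φₖ(x)` (which exist everywhere) satisfy `Φ(b) - Φ(a) = ∫_a^b g` for all real `a, b`. [folklore] -/
theorem limUnder_sub_limUnder_eq_integral {φ ψ : ℕ → ℝ → E}
    (hderiv : ∀ k x, HasDerivAt (φ k) (ψ k x) x) (hψc : ∀ k, Continuous (ψ k)) {f g : ℝ → E}
    (hfi : ∀ M : ℕ, IntervalIntegrable f volume (-(M : ℝ)) M) (hgi : ∀ M : ℕ, IntervalIntegrable g volume (-(M : ℝ)) M)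
    (hφ : ∀ M : ℕ, Tendsto (fun k => ∫ x in (-(M : ℝ))..M, ‖φ k x - f x‖) atTop (𝓝 0))
    (hψ : ∀ M : ℕ, Tendsto (fun k => ∫ x in (-(M : ℝ))..M, ‖ψ k x - g x‖) atTop (𝓝 0)) (a b : ℝ) :
    IntervalIntegrable g volume a b ∧
      limUnder atTop (fun k => φ k b) - limUnder atTop (fun k => φ k a) = ∫ x in a..b, g x := by
  -- a box `[-(M+1), M+1]` containing `a` and `b`
  obtain ⟨M, hM⟩ : ∃ M : ℕ, max |a| |b| ≤ M := exists_nat_ge _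
  have hle : (-((M + 1 : ℕ) : ℝ)) < ((M + 1 : ℕ) : ℝ) := by push_cast; linarith
  have hmem : ∀ c : ℝ, |c| ≤ M → c ∈ Icc (-((M + 1 : ℕ) : ℝ)) ((M + 1 : ℕ) : ℝ) := fun c hc => by
    rw [mem_Icc]; push_cast; constructor <;> linarith [(abs_le.1 hc).1, (abs_le.1 hc).2]
  have ha : a ∈ Icc (-((M + 1 : ℕ) : ℝ)) ((M + 1 : ℕ) : ℝ) := hmem a ((le_max_left _ _).trans hM)
  have hb : b ∈ Icc (-((M + 1 : ℕ) : ℝ)) ((M + 1 : ℕ) : ℝ) := hmem b ((le_max_right _ _).trans hM)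
  obtain ⟨F, -, hptw, hsub, -⟩ := exists_primitive_of_tendsto_L1 hle hderiv hψc (hfi (M + 1)) (hgi (M + 1))
    (hφ (M + 1)) (hψ (M + 1))
  refine ⟨intervalIntegrable_of_mem_Icc hle.le ha hb (hgi (M + 1)), ?_⟩
  rw [(hptw b hb).limUnder_eq, (hptw a ha).limUnder_eq]
  exact hsub a ha b hb

end Literature.Analysis.FunctionSpaces

end
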